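import Literature.Computability.QuantumComplexity.IQPSimulationTransfer
import Literature.Computability.Complexity.StringSwap
import Literature.Computability.Complexity.CountingHierarchyInter
import Literature.Computability.Complexity.MajorityVote
import HarnessLib

/-!
# Post-BPP does not depend on the error tolerance (discharge of `PostBPPWith_subset_PostBPP`)

Family `quantum-advantage`; trunk material `CplxCore`. This file proves the named fact
`Literature.Computability.QuantumComplexity.PostBPPWith_subset_PostBPP` of `IQPSimulationTransfer.lean`
(`PostBPPWith_subset_PostBPP_holds`): for every tolerance `0 < ε < 1/2`,
`PostBPPWith ε ⊆ PostBPP` (the tree's post-BPP has the thresholds `2/3, 1/3`). This is the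
remark of Bremner–Jozsa–Shepherd (Proc. R. Soc. A 467 (2011), arXiv:1005.1407, §2.4, p. 6,
after Def. 3): "the standard method for reducing `ε` is to consider the majority vote answer of
multiple runs of the circuit. Similarly post-BPP and post-BQP are easily seen to be independent
of the error tolerance value too" (for `BPP_path = post-BPP` this is Han–Hemaspaandra–Thierauf
1997, Thm. 3.1). It is one of the two residual leaves of BJS Thm. 2 in the tree's DAG for
`PH_eq_DeltaP_three_of_uniform_iqp_multiplicative` (BJS Cor. 1).

## The printed argument, as formalised

Let `L ∈ PostBPPWith ε` via `R, S ∈ P` and coin polynomial `p` (`Pr_r[⟨x,r⟩ ∈ S] > 0`,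
`Pr[S ∧ R] ≥ (1-ε) Pr[S]` on `x ∈ L`, `≤ ε Pr[S]` off `L`, `r` uniform in `{0,1}^{p|x|}`).
Put `η = 1/2 - ε > 0` and fix a **constant** number `k + 1 ≥ 3/(4η²)` of runs. New coins have
length `p(|x|)·(k+1)`; run `c ≤ k` uses the coins at the positions `c, c+(k+1), c+2(k+1), …`
(`stride k c r`, a finite-state transduction, `strideT`; on pairs `blockFn k c ⟨x,r⟩ =
⟨x, stride k c r⟩ ∈ FP` by `mapSndFn_mem_FP`). Post-select on *all* runs post-selecting
(`ampPost S k = ⋂_c blockFn k c ⁻¹' S ∈ P`, `forall_fin_mem_P`) and accept on a strict majority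
of accepting runs (`ampAcc R k = {k+1 < 2·#{c | blockFn k c w ∈ R}} ∈ P`, `threshold_mem_P`:
threshold counts of `P`-predicates are in `P` by induction on the number of predicates). The
strides form a bijection `{0,1}^{m(k+1)} ≃ ({0,1}^m)^{k+1}` (`strideVec_bijective`: injective by
block peeling `stride_append_of_length`, and the cardinalities agree), so
`Pr[all runs post-select] = |Sₓ|^{k+1}/2^{m(k+1)} > 0` and, *conditioned on it*, the runs are
independent and uniform on `Sₓ = {r | ⟨x,r⟩ ∈ S}`, of which a `≥ 1 - ε = 1/2 + η` fraction is
good (in `R` if `x ∈ L`, outside `R` if `x ∉ L`). By the Chebyshev majority bound of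
`MajorityVote.lean` (`card_majority_fail_le`, `δ = 1/3`, `k+1 ≥ 1/(4δη²)`) at most a third of
the `(k+1)`-tuples from `Sₓ` fail to have a strict good majority, which gives the thresholds
`2/3` and `1/3` of `PostBPP`.

## Contents

* `stride`, `stride_append_of_length` (block peeling), `length_stride`, `eq_of_stride_eq`;
  the transducer `strideT` (`strideT_eval`), `blockFn` (`blockFn_boolPair`, `blockFn_mem_FP`);
* `forall_fin_mem_P`, `threshold_mem_P` (closure of `P`; with `top_mem_P`/`bot_mem_P` of
  `CountingHierarchyInter.lean`);
* `strideVec_bijective`, `card_filter_stride` (counting transfer), `card_filter_forall_mem`,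
  `card_forall_mem_majority_fail_le` (`δ = 1/3` majority bound for tuples from a finset);
* `ampPost`, `ampAcc` (`_mem_P`, `boolPair_mem_…`), `uniformProb` bookkeeping, and
  `PostBPPWith_subset_PostBPP_holds`.

## References

* M. J. Bremner, R. Jozsa, D. J. Shepherd, *Classical simulation of commuting quantum
  computations implies collapse of the polynomial hierarchy*, Proc. R. Soc. A 467 (2011)
  459–472, arXiv:1005.1407: Def. 3 (post-BPP with tolerance `ε`), §2.4 p. 6 (tolerance
  independence by majority vote).
* Y. Han, L. A. Hemaspaandra, T. Thierauf, *Threshold computation and cryptographic security*,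
  SIAM J. Comput. 26 (1997) 59–78, §3 (`BPP_path`), Thm. 3.1.
* S. Arora, B. Barak, *Computational Complexity: A Modern Approach*, CUP 2009, §7.4.1 (error
  reduction by majority; Chebyshev suffices for constant error).
* Mathlib: `Fintype.bijective_iff_injective_and_card`, `Equiv.subtypePiEquivPi`,
  `Fintype.card_piFinset_const`, `Finset.filter_attach`, `Fin.sum_univ_succ`.
-/

namespace Literature.Computability.QuantumComplexity

open _root_.Computability Finset

/-! ### Strided sub-strings -/

/-- `stride k c r`: skip `c` symbols of `r`, keep one, skip `k`, keep one, skip `k`, … — the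
symbols of `r` at the positions `c, c + (k+1), c + 2(k+1), …` (run number `c` of `k+1`
interleaved runs). [Arora–Barak 2009, §7.4.1 (independent repetitions)] [folklore] -/
def stride (k : ℕ) : ℕ → List Bool → List Bool
  | _, [] => []
  | 0, b :: r => b :: stride k k r
  | c + 1, _ :: r => stride k c r

/-- The stride of the empty word is empty. [folklore] -/
@[simp] theorem stride_nil (k c : ℕ) : stride k c [] = [] := by
  cases c <;> rfl

/-- At counter `0` the symbol is kept and the counter resets to `k`. [folklore] -/
@[simp] theorem stride_zero_cons (k : ℕ) (b : Bool) (r : List Bool) :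
    stride k 0 (b :: r) = b :: stride k k r := rfl

/-- At a positive counter the symbol is skipped. [folklore] -/
@[simp] theorem stride_succ_cons (k c : ℕ) (b : Bool) (r : List Bool) :
    stride k (c + 1) (b :: r) = stride k c r := rfl

/-- Skipping a prefix: `stride k (c + |a|) (a ++ r) = stride k c r`. [folklore] -/
theorem stride_add_length_append (k c : ℕ) (a r : List Bool) :
    stride k (c + a.length) (a ++ r) = stride k c r := by
  induction a generalizing c with
  | nil => simp
  | cons b a ih =>
    rw [List.length_cons, ← Nat.add_assoc, List.cons_append, stride_succ_cons]
    exact ih c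

/-- Skipping a prefix of exactly the counter's length. [folklore] -/
theorem stride_append_of_length_eq {k c : ℕ} {a : List Bool} (ha : a.length = c) (r : List Bool) :
    stride k c (a ++ r) = stride k 0 r := by
  simpa [ha] using stride_add_length_append k 0 a r

/-- **Block peeling**: on a word starting with a full period `a` (`|a| = k+1`), the stride from
offset `c ≤ k` is the symbol `a.getI c` followed by the same stride of the rest. [folklore] -/
theorem stride_append_of_length {k c : ℕ} {a : List Bool} (ha : a.length = k + 1) (hc : c ≤ k)
    (r : List Bool) :
    stride k c (a ++ r) = a.getI c :: stride k c r := by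
  obtain ⟨a₁, a₂, rfl, h1⟩ : ∃ a₁ a₂, a = a₁ ++ a₂ ∧ a₁.length = c :=
    ⟨a.take c, a.drop c, (List.take_append_drop c a).symm, by rw [List.length_take]; omega⟩
  obtain ⟨b, a₃, rfl⟩ : ∃ b a₃, a₂ = b :: a₃ := by
    cases a₂ with
    | nil => simp at ha; omega
    | cons b a₃ => exact ⟨b, a₃, rfl⟩
  have h3 : k = c + a₃.length := by simp at ha; omega
  rw [List.append_assoc, stride_append_of_length_eq h1, List.cons_append, stride_zero_cons,
    List.getI_append_right _ _ _ (by omega), h1, Nat.sub_self, List.getI_cons_zero]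
  congr 1
  have := stride_add_length_append k c a₃ r
  rwa [← h3] at this

/-- Length of a stride of a word of `m` full periods: `m`. [folklore] -/
theorem length_stride {k c : ℕ} (hc : c ≤ k) {m : ℕ} :
    ∀ {r : List Bool}, r.length = m * (k + 1) → (stride k c r).length = m := by
  induction m with
  | zero =>
    intro r hr
    rw [Nat.zero_mul, List.length_eq_zero_iff] at hr
    subst hr
    simp
  | succ m ih =>
    intro r hr
    have hlen : (r.take (k + 1)).length = k + 1 := by
      rw [List.length_take]; rw [Nat.succ_mul] at hr; omega
    have hrest : (r.drop (k + 1)).length = m * (k + 1) := by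
      rw [List.length_drop, hr, Nat.succ_mul]; omega
    rw [← List.take_append_drop (k + 1) r, stride_append_of_length hlen hc, List.length_cons,
      ih hrest]

/-- **Strides determine the word**: two words of `m` full periods with the same strides at
every offset `c ≤ k` are equal (peel one period and induct). [folklore] -/
theorem eq_of_stride_eq {k m : ℕ} :
    ∀ {r r' : List Bool}, r.length = m * (k + 1) → r'.length = m * (k + 1) →
      (∀ c ≤ k, stride k c r = stride k c r') → r = r' := by
  induction m with
  | zero =>
    intro r r' hr hr' _
    rw [Nat.zero_mul, List.length_eq_zero_iff] at hr hr'
    rw [hr, hr']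
  | succ m ih =>
    intro r r' hr hr' h
    have hlen : (r.take (k + 1)).length = k + 1 := by
      rw [List.length_take]; rw [Nat.succ_mul] at hr; omega
    have hrest : (r.drop (k + 1)).length = m * (k + 1) := by
      rw [List.length_drop, hr, Nat.succ_mul]; omega
    have hlen' : (r'.take (k + 1)).length = k + 1 := by
      rw [List.length_take]; rw [Nat.succ_mul] at hr'; omega
    have hrest' : (r'.drop (k + 1)).length = m * (k + 1) := by
      rw [List.length_drop, hr', Nat.succ_mul]; omega
    have h' : ∀ c, c ≤ k → (r.take (k + 1)).getI c :: stride k c (r.drop (k + 1)) =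
        (r'.take (k + 1)).getI c :: stride k c (r'.drop (k + 1)) := by
      intro c hc
      rw [← stride_append_of_length hlen hc, ← stride_append_of_length hlen' hc,
        List.take_append_drop, List.take_append_drop]
      exact h c hc
    rw [← List.take_append_drop (k + 1) r, ← List.take_append_drop (k + 1) r']
    congr 1
    · refine List.ext_getElem (by rw [hlen, hlen']) fun c h1 h2 => ?_
      have := (List.cons_eq_cons.1 (h' c (by omega))).1
      rwa [List.getI_eq_getElem _ h1, List.getI_eq_getElem _ h2] at this
    · exact ih hrest hrest' fun c hc => (List.cons_eq_cons.1 (h' c hc)).2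

/-! ### The stride transducer and the block maps -/

/-- Transition of the stride transducer: the state counts the symbols still to be skipped
before the next kept one. [Hopcroft–Ullman 1979, §2.7 (Mealy machines)] [folklore] -/
def strideStep (k : ℕ) : Fin (k + 1) → Bool → Fin (k + 1) × List Bool
  | ⟨0, _⟩, b => (Fin.last k, [b])
  | ⟨j + 1, h⟩, _ => (⟨j, by omega⟩, [])

/-- Transition at counter `0`: keep the symbol, reset the counter to `k`. [folklore] -/
@[simp] theorem strideStep_zero (k : ℕ) (h : 0 < k + 1) (b : Bool) :
    strideStep k ⟨0, h⟩ b = (Fin.last k, [b]) := rfl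

/-- Transition at a positive counter: skip the symbol, decrement. [folklore] -/
@[simp] theorem strideStep_succ (k j : ℕ) (h : j + 1 < k + 1) (b : Bool) :
    strideStep k ⟨j + 1, h⟩ b = (⟨j, by omega⟩, []) := rfl

/-- The finite-state transducer computing `stride k c` (initial counter `c`).
[Hopcroft–Ullman 1979, §2.7] [folklore] -/
def strideT (k : ℕ) (c : Fin (k + 1)) : Complexity.FST (Fin (k + 1)) Bool Bool where
  init := c
  step := strideStep k
  front := fun _ => []
  keep := fun _ => true

/-- The transition of `strideT` (definitional). [folklore] -/
@[simp] theorem strideT_step (k : ℕ) (c : Fin (k + 1)) : (strideT k c).step = strideStep k := rfl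

/-- The run of `strideT` from counter `s` emits `stride k s`. [folklore] -/
theorem strideT_run (k : ℕ) (c s : Fin (k + 1)) (r : List Bool) :
    ((strideT k c).run s r).2 = stride k s.val r := by
  induction r generalizing s with
  | nil => simp
  | cons b r ih =>
    rcases s with ⟨_ | j, hs⟩
    · rw [Complexity.FST.run_cons, strideT_step, strideStep_zero, ih]; rfl
    · rw [Complexity.FST.run_cons, strideT_step, strideStep_succ, ih]; rfl

/-- **`strideT k c` computes `stride k c`.** [folklore] -/
theorem strideT_eval (k : ℕ) (c : Fin (k + 1)) (r : List Bool) :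
    (strideT k c).eval r = stride k c.val r := by
  rw [Complexity.FST.eval, strideT_run]; rfl

/-- The block map of run `c`: `⟨x, r⟩ ↦ ⟨x, stride k c r⟩` (`mapSndFn` of the stride
transduction). [Arora–Barak 2009, §7.4.1] [folklore] -/
noncomputable def blockFn (k : ℕ) (c : Fin (k + 1)) : List Bool → List Bool :=
  Complexity.mapSndFn (strideT k c).eval

/-- `blockFn k c ⟨x, r⟩ = ⟨x, stride k c r⟩`. [folklore] -/
@[simp] theorem blockFn_boolPair (k : ℕ) (c : Fin (k + 1)) (x r : List Bool) :
    blockFn k c (Complexity.boolPair x r) = Complexity.boolPair x (stride k c.val r) := by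
  simp [blockFn, strideT_eval]

/-- The block maps are polynomial-time. [Arora–Barak 2009, Thm. 2.8] [folklore] -/
theorem blockFn_mem_FP (k : ℕ) (c : Fin (k + 1)) : blockFn k c ∈ Complexity.FP :=
  Complexity.mapSndFn_mem_FP (strideT k c).polyTimeComputable_eval

/-! ### Closure properties of `P` -/

/-- Transport of membership in `P` along extensional equality of languages. [folklore] -/
theorem mem_P_of_forall_iff {L L' : Language Bool} (hL' : L' ∈ Complexity.Classes.P) (h : ∀ w, w ∈ L ↔ w ∈ L') :
    L ∈ Complexity.Classes.P := by
  have : L = L' := Set.ext h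
  rw [this]; exact hL'

/-- **`P` is closed under finite intersections** indexed by `Fin n` (iterate `inter_mem_P`).
[Arora–Barak 2009, §1.3, Claim 1.6] [folklore] -/
theorem forall_fin_mem_P {n : ℕ} (L : Fin n → Language Bool) (hL : ∀ i, L i ∈ Complexity.Classes.P) :
    {w | ∀ i, w ∈ L i} ∈ Complexity.Classes.P := by
  induction n with
  | zero => exact mem_P_of_forall_iff (show (Set.univ : Set (List Bool)) ∈ Complexity.Classes.P from Complexity.top_mem_P) fun w => by simp
  | succ n ih =>
    refine mem_P_of_forall_iff (Complexity.inter_mem_P (hL 0) (ih (fun i => L i.succ) fun i => hL i.succ))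
      fun w => ?_
    simp only [Fin.forall_fin_succ]
    rfl

open scoped Classical in
/-- **Threshold counting of `P`-predicates is in `P`**: for languages `L₀, …, Lₙ₋₁ ∈ P` and a
threshold `s`, the words lying in at least `s` of them form a language in `P`
(`{w | s ≤ #{i | w ∈ Lᵢ}}`; induction on `n`, splitting on membership in `L₀`; in particular
the majority vote of `n` polynomial-time tests is polynomial-time).
[Arora–Barak 2009, §7.4.1 (majority of runs), §1.3] [folklore] -/
theorem threshold_mem_P {n : ℕ} (L : Fin n → Language Bool) (hL : ∀ i, L i ∈ Complexity.Classes.P) (s : ℕ) :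
    {w | s ≤ (univ.filter fun i => w ∈ L i).card} ∈ Complexity.Classes.P := by
  induction n generalizing s with
  | zero =>
    cases s with
    | zero => exact mem_P_of_forall_iff (show (Set.univ : Set (List Bool)) ∈ Complexity.Classes.P from Complexity.top_mem_P) fun w => by simp
    | succ s => exact mem_P_of_forall_iff (show (∅ : Set (List Bool)) ∈ Complexity.Classes.P from Complexity.bot_mem_P) fun w => by simp
  | succ n ih =>
    cases s with
    | zero => exact mem_P_of_forall_iff (show (Set.univ : Set (List Bool)) ∈ Complexity.Classes.P from Complexity.top_mem_P) fun w => by simp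
    | succ s =>
      have hcount : ∀ w : List Bool, (univ.filter fun i : Fin (n + 1) => w ∈ L i).card =
          (if w ∈ L 0 then 1 else 0) + (univ.filter fun i : Fin n => w ∈ L i.succ).card := by
        intro w
        rw [Finset.card_filter, Fin.sum_univ_succ, Finset.card_filter]
      have h1 := ih (fun i => L i.succ) (fun i => hL i.succ) s
      have h2 := ih (fun i => L i.succ) (fun i => hL i.succ) (s + 1)
      refine mem_P_of_forall_iff (Complexity.union_mem_P (Complexity.inter_mem_P (hL 0) h1) h2) fun w => ?_
      change s + 1 ≤ (univ.filter fun i : Fin (n + 1) => w ∈ L i).card ↔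
        (w ∈ L 0 ∧ s ≤ (univ.filter fun i : Fin n => w ∈ L i.succ).card) ∨
          s + 1 ≤ (univ.filter fun i : Fin n => w ∈ L i.succ).card
      rw [hcount w]
      by_cases hw : w ∈ L 0
      · simp only [hw, if_true, true_and]
        omega
      · simp only [hw, if_false, Nat.zero_add, false_and, false_or]

/-! ### Strides as a bijection with tuples of blocks; counting -/

/-- The tuple of the `k+1` strides of a word of `m` full periods, as length-`m` vectors.
[folklore] -/
def strideVec (k m : ℕ) (v : List.Vector Bool (m * (k + 1))) (c : Fin (k + 1)) :
    List.Vector Bool m :=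
  ⟨stride k c.val v.toList, length_stride (Nat.le_of_lt_succ c.isLt) v.toList_length⟩

/-- Components of `strideVec` (definitional). [folklore] -/
@[simp] theorem toList_strideVec (k m : ℕ) (v : List.Vector Bool (m * (k + 1))) (c : Fin (k + 1)) :
    (strideVec k m v c).toList = stride k c.val v.toList := rfl

/-- `strideVec` is injective (`eq_of_stride_eq`). [folklore] -/
theorem strideVec_injective (k m : ℕ) : Function.Injective (strideVec k m) := by
  intro v w h
  rcases v with ⟨r, hr⟩
  rcases w with ⟨r', hr'⟩
  apply Subtype.ext
  refine eq_of_stride_eq hr hr' fun c hc => ?_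
  have := congrArg (fun f => (f ⟨c, Nat.lt_succ_of_le hc⟩).toList) h
  simpa using this

/-- **The strides form a bijection** `{0,1}^{m(k+1)} ≃ ({0,1}^m)^{k+1}` (injective, and both
sides have `2^{m(k+1)}` elements). [Arora–Barak 2009, §7.4.1 (independent runs)] [folklore] -/
theorem strideVec_bijective (k m : ℕ) : Function.Bijective (strideVec k m) := by
  rw [Fintype.bijective_iff_injective_and_card]
  refine ⟨strideVec_injective k m, ?_⟩
  rw [Fintype.card_pi_const, card_vector, card_vector, Fintype.card_bool, ← pow_mul]

/-- **Counting transfer**: the number of words of length `m(k+1)` whose stride tuple satisfies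
`Q` equals the number of `(k+1)`-tuples of length-`m` words satisfying `Q`. [folklore] -/
theorem card_filter_stride (k m : ℕ) (Q : (Fin (k + 1) → List Bool) → Prop) [DecidablePred Q]
    [DecidablePred fun v : List.Vector Bool (m * (k + 1)) => Q fun c => stride k c.val v.toList] :
    (univ.filter fun v : List.Vector Bool (m * (k + 1)) => Q fun c => stride k c.val v.toList).card =
      (univ.filter fun b : Fin (k + 1) → List.Vector Bool m => Q fun c => (b c).toList).card := by
  rw [← Fintype.card_subtype, ← Fintype.card_subtype]
  exact Fintype.card_congr ((Equiv.ofBijective _ (strideVec_bijective k m)).subtypeEquiv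
    fun v => Iff.rfl)

/-- Tuples with all components in `s` and satisfying `F` are counted by functions into `s`.
[folklore] -/
theorem card_filter_forall_mem_and {α ι : Type*} [Fintype ι] [DecidableEq ι] [DecidableEq α]
    (s : Finset α) (F : (ι → α) → Prop) [DecidablePred F] [Fintype α]
    [DecidablePred fun b : ι → α => (∀ i, b i ∈ s) ∧ F b]
    [DecidablePred fun ω : ι → s => F fun i => (ω i).1] :
    (univ.filter fun b : ι → α => (∀ i, b i ∈ s) ∧ F b).card =
      (univ.filter fun ω : ι → s => F fun i => (ω i).1).card := by
  rw [← Fintype.card_subtype, ← Fintype.card_subtype]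
  refine Fintype.card_congr ?_
  exact (Equiv.subtypeSubtypeEquivSubtypeInter (fun b : ι → α => ∀ i, b i ∈ s) F).symm.trans
    ((Equiv.subtypePiEquivPi (p := fun _ a => a ∈ s)).subtypeEquiv fun b => Iff.rfl)

/-- Tuples with all components in `s`: `|s|^n` of them. [folklore] -/
theorem card_filter_forall_mem {α : Type*} [Fintype α] [DecidableEq α] (s : Finset α) (n : ℕ)
    [DecidablePred fun b : Fin n → α => ∀ i, b i ∈ s] :
    (univ.filter fun b : Fin n → α => ∀ i, b i ∈ s).card = s.card ^ n := by
  rw [← Fintype.card_piFinset_const]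
  congr 1
  ext b
  simp [Fintype.mem_piFinset]

/-- Good elements of `s`, counted on the subtype. [folklore] -/
theorem card_filter_univ_coe {α : Type*} (s : Finset α) (good : α → Prop) [DecidablePred good] :
    (univ.filter fun v : s => good v.1).card = (s.filter good).card := by
  rw [Finset.univ_eq_attach, Finset.filter_attach, Finset.card_map, Finset.card_attach]

/-- **Majority failure among tuples from `s`** (the `δ = 1/3` instance of
`card_majority_fail_le`): if a `≥ 1/2 + η` fraction of a nonempty finset `s` is good and
`n ≥ 3/(4η²)`, then among the `|s|^n` `n`-tuples of elements of `s` at most a third fail to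
have a strict majority of good components. [Kranakis 1986, Thm. 3.5; Blum–Micali 1984, §3.3]
[cite: Kranakis1986, Thm. 3.5] -/
theorem card_forall_mem_majority_fail_le {α : Type*} [Fintype α] [DecidableEq α] (s : Finset α)
    (hs : s.Nonempty) (good : α → Prop) [DecidablePred good] {n : ℕ} {η : ℝ} (hη : 0 < η)
    (hn : 3 / (4 * η ^ 2) ≤ n) (hgood : (1 / 2 + η) * s.card ≤ (s.filter good).card)
    [DecidablePred fun b : Fin n → α =>
      (∀ i, b i ∈ s) ∧ 2 * (univ.filter fun i => good (b i)).card ≤ n] :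
    ((univ.filter fun b : Fin n → α =>
        (∀ i, b i ∈ s) ∧ 2 * (univ.filter fun i => good (b i)).card ≤ n).card : ℝ) ≤
      1 / 3 * (s.card : ℝ) ^ n := by
  classical
  haveI : Nonempty s := hs.to_subtype
  rw [card_filter_forall_mem_and s
    (fun b : Fin n → α => 2 * (univ.filter fun i => good (b i)).card ≤ n)]
  have h := Complexity.card_majority_fail_le (fun v : s => good v.1) hη (by norm_num : (0 : ℝ) < 1 / 3)
    (by rw [show 1 / (4 * (1 / 3 : ℝ) * η ^ 2) = 3 / (4 * η ^ 2) by ring]; exact hn)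
    (by rw [Fintype.card_coe, card_filter_univ_coe]; exact hgood)
  rw [Fintype.card_pi_const, Fintype.card_coe] at h
  push_cast at h
  convert h using 3

/-! ### `uniformProb` bookkeeping -/

/-- `uniformProb` as a normalised count over `List.Vector Bool m` (definitional). [folklore] -/
theorem uniformProb_eq_card_filter (m : ℕ) (E : Set (List Bool))
    [DecidablePred fun r : List.Vector Bool m => r.toList ∈ E] :
    Complexity.uniformProb m E = ((univ.filter fun r : List.Vector Bool m => r.toList ∈ E).card : ℝ) / 2 ^ m := by
  unfold Complexity.uniformProb
  congr

/-- Additivity: `Pr[E ∧ F] + Pr[E ∧ ¬F] = Pr[E]`. [Arora–Barak 2009, §7.1] [folklore] -/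
theorem uniformProb_inter_add_inter_compl (m : ℕ) (E F : Set (List Bool)) :
    Complexity.uniformProb m {r | r ∈ E ∧ r ∈ F} + Complexity.uniformProb m {r | r ∈ E ∧ r ∉ F} = Complexity.uniformProb m E := by
  classical
  rw [uniformProb_eq_card_filter, uniformProb_eq_card_filter, uniformProb_eq_card_filter,
    ← add_div]
  congr 1
  have h := Finset.card_filter_add_card_filter_not
    (s := univ.filter fun r : List.Vector Bool m => r.toList ∈ E) (fun r => r.toList ∈ F)
  rw [Finset.filter_filter, Finset.filter_filter] at h
  exact_mod_cast h

/-- Monotonicity on strings of length `m`. [Arora–Barak 2009, §7.1] [folklore] -/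
theorem uniformProb_mono_of_length {m : ℕ} {E F : Set (List Bool)}
    (h : ∀ r : List Bool, r.length = m → r ∈ E → r ∈ F) : Complexity.uniformProb m E ≤ Complexity.uniformProb m F := by
  classical
  rw [uniformProb_eq_card_filter, uniformProb_eq_card_filter]
  refine div_le_div_of_nonneg_right ?_ (by positivity)
  exact_mod_cast Finset.card_le_card fun r hr => by
    simp only [Finset.mem_filter, Finset.mem_univ, true_and] at hr ⊢
    exact h _ r.toList_length hr

end Literature.Computability.QuantumComplexity

namespace Literature.Computability.QuantumComplexity

open _root_.Computability Finset Complexity Complexity.Classes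

/-! ### The amplified predicates -/

/-- **All runs post-select**: `ampPost S k = {w | ∀ c ≤ k, blockFn k c w ∈ S}`.
(BJS 2011, §2.4: repeat the post-selected computation.) [cite: BremnerJozsaShepherdPRSA2011, §2.4 (p. 6, after Def. 3)] -/
def ampPost (S : Language Bool) (k : ℕ) : Language Bool :=
  {w | ∀ c : Fin (k + 1), blockFn k c w ∈ S}

open scoped Classical in
/-- **A strict majority of runs accept**: `ampAcc R k = {w | k+1 < 2·#{c | blockFn k c w ∈ R}}`.
(BJS 2011, §2.4: "the majority vote answer of multiple runs".) [cite: BremnerJozsaShepherdPRSA2011, §2.4 (p. 6, after Def. 3)] -/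
noncomputable def ampAcc (R : Language Bool) (k : ℕ) : Language Bool :=
  {w | k + 1 < 2 * (univ.filter fun c : Fin (k + 1) => blockFn k c w ∈ R).card}

/-- Membership of a pair in `ampPost`: every stride post-selects. [folklore] -/
theorem boolPair_mem_ampPost (S : Language Bool) (k : ℕ) (x r : List Bool) :
    boolPair x r ∈ ampPost S k ↔ ∀ c : Fin (k + 1), boolPair x (stride k c.val r) ∈ S := by
  change (∀ c : Fin (k + 1), blockFn k c (boolPair x r) ∈ S) ↔ _
  simp only [blockFn_boolPair]

open scoped Classical in
/-- Membership of a pair in `ampAcc`: a strict majority of the strides accept. [folklore] -/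
theorem boolPair_mem_ampAcc (R : Language Bool) (k : ℕ) (x r : List Bool) :
    boolPair x r ∈ ampAcc R k ↔
      k + 1 < 2 * (univ.filter fun c : Fin (k + 1) => boolPair x (stride k c.val r) ∈ R).card := by
  change k + 1 < 2 * (univ.filter fun c : Fin (k + 1) => blockFn k c (boolPair x r) ∈ R).card ↔ _
  simp only [blockFn_boolPair]

/-- `ampPost S k ∈ P` for `S ∈ P` (finite intersection of `FP`-preimages).
[Arora–Barak 2009, §7.4.1, Thm. 2.8] [folklore] -/
theorem ampPost_mem_P {S : Language Bool} (hS : S ∈ P) (k : ℕ) : ampPost S k ∈ P :=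
  forall_fin_mem_P (fun c => blockFn k c ⁻¹' S) fun c => preimage_mem_P hS (blockFn_mem_FP k c)

/-- `ampAcc R k ∈ P` for `R ∈ P` (a threshold count of `FP`-preimages).
[Arora–Barak 2009, §7.4.1, Thm. 2.8] [folklore] -/
theorem ampAcc_mem_P {R : Language Bool} (hR : R ∈ P) (k : ℕ) : ampAcc R k ∈ P := by
  classical
  have h := threshold_mem_P (fun c => blockFn k c ⁻¹' R)
    (fun c => preimage_mem_P hR (blockFn_mem_FP k c)) ((k + 1) / 2 + 1)
  refine mem_P_of_forall_iff h fun w => ?_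
  change k + 1 < 2 * (univ.filter fun c : Fin (k + 1) => blockFn k c w ∈ R).card ↔
    (k + 1) / 2 + 1 ≤ (univ.filter fun c : Fin (k + 1) => blockFn k c w ∈ R).card
  omega

/-! ### The discharge -/

/-- There is a constant number of runs `k + 1 ≥ 3/(4η²)`. [folklore] -/
theorem exists_numRuns_ge (η : ℝ) : ∃ k : ℕ, 3 / (4 * η ^ 2) ≤ ((k + 1 : ℕ) : ℝ) :=
  ⟨⌈3 / (4 * η ^ 2)⌉₊, by push_cast; exact (Nat.le_ceil _).trans (by linarith)⟩

/-- **Discharge of `PostBPPWith_subset_PostBPP`** (post-BPP is independent of the error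
tolerance `0 < ε < 1/2`): majority vote over `k+1 ≥ 3/(4η²)` interleaved runs
(`η = 1/2 - ε`), post-selecting on all runs post-selecting; conditioned on that event the runs
are independent and uniform on the post-selected coin strings, so the Chebyshev majority bound
(`card_forall_mem_majority_fail_le`) yields the thresholds `2/3, 1/3`.
(BJS 2011, §2.4, p. 6: "the standard method for reducing `ε` is to consider the majority vote
answer of multiple runs … post-BPP and post-BQP are easily seen to be independent of the error
tolerance value too"; Han–Hemaspaandra–Thierauf 1997, Thm. 3.1 for `BPP_path`.) [cite: BremnerJozsaShepherdPRSA2011, §2.4 (p. 6, after Def. 3)] -/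
theorem PostBPPWith_subset_PostBPP_holds : PostBPPWith_subset_PostBPP := by
  intro ε hε0 hε1 L hL
  obtain ⟨R, hR, S, hS, p, h⟩ := hL
  classical
  -- the margin and the number of runs
  set η : ℝ := 1 / 2 - ε with hη
  have hη0 : 0 < η := by rw [hη]; linarith
  obtain ⟨k, hk⟩ := exists_numRuns_ge η
  refine ⟨ampAcc R k, ampAcc_mem_P hR k, ampPost S k, ampPost_mem_P hS k,
    p * Polynomial.C (k + 1), fun x => ?_⟩
  obtain ⟨hpos, hyes, hno⟩ := h x
  -- coins: `m` per run, `m (k+1)` in total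
  set m : ℕ := p.eval x.length with hm
  have hev : (p * Polynomial.C (k + 1)).eval x.length = m * (k + 1) := by
    simp [Polynomial.eval_mul, hm]
  rw [hev]
  -- the one-run statistics as counts over `List.Vector Bool m`
  set Sx : Finset (List.Vector Bool m) := univ.filter fun v => boolPair x v.toList ∈ S with hSx
  set good : List.Vector Bool m → Prop := fun v => boolPair x v.toList ∈ R with hgood_def
  have hPS : uniformProb m {r | boolPair x r ∈ S} = (Sx.card : ℝ) / 2 ^ m := by
    rw [uniformProb_eq_card_filter]
    rfl
  have hPSR : uniformProb m {r | boolPair x r ∈ S ∧ boolPair x r ∈ R} =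
      ((Sx.filter good).card : ℝ) / 2 ^ m := by
    rw [uniformProb_eq_card_filter, hSx, Finset.filter_filter]
    rfl
  have h2m : (0 : ℝ) < 2 ^ m := by positivity
  have hSxpos : (0 : ℝ) < Sx.card := by
    rw [hPS] at hpos
    exact (div_pos_iff_of_pos_right h2m).1 hpos
  have hSxne : Sx.Nonempty := by
    rw [← Finset.card_pos]; exact_mod_cast hSxpos
  -- the new statistics, transferred to tuples of blocks
  have h2n : (0 : ℝ) < 2 ^ (m * (k + 1)) := by positivity
  have hPost : uniformProb (m * (k + 1)) {r | boolPair x r ∈ ampPost S k} =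
      ((Sx.card : ℝ) ^ (k + 1)) / 2 ^ (m * (k + 1)) := by
    rw [uniformProb_eq_card_filter]
    congr 1
    have h1 : (univ.filter fun v : List.Vector Bool (m * (k + 1)) =>
        v.toList ∈ {r | boolPair x r ∈ ampPost S k}) =
        univ.filter fun v : List.Vector Bool (m * (k + 1)) =>
          (fun f : Fin (k + 1) → List Bool => ∀ c, boolPair x (f c) ∈ S)
            fun c => stride k c.val v.toList := by
      refine Finset.filter_congr fun v _ => ?_
      exact boolPair_mem_ampPost S k x v.toList
    rw [h1, card_filter_stride k m (fun f : Fin (k + 1) → List Bool => ∀ c, boolPair x (f c) ∈ S)]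
    have h2 : (univ.filter fun b : Fin (k + 1) → List.Vector Bool m =>
        (fun f : Fin (k + 1) → List Bool => ∀ c, boolPair x (f c) ∈ S) fun c => (b c).toList) =
        univ.filter fun b : Fin (k + 1) → List.Vector Bool m => ∀ c, b c ∈ Sx := by
      refine Finset.filter_congr fun b _ => ?_
      simp [hSx]
    rw [h2, card_filter_forall_mem]
    push_cast
    rfl
  have hPostPos : 0 < uniformProb (m * (k + 1)) {r | boolPair x r ∈ ampPost S k} := by
    rw [hPost]; positivity
  -- failure of a strict `gd`-majority among the runs, on the event that all runs post-select
  have hFail : ∀ (gd : List Bool → Prop) [DecidablePred gd],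
      (1 / 2 + η) * Sx.card ≤ (Sx.filter fun v => gd v.toList).card →
      uniformProb (m * (k + 1)) {r | (∀ c : Fin (k + 1), boolPair x (stride k c.val r) ∈ S) ∧
          2 * (univ.filter fun c : Fin (k + 1) => gd (stride k c.val r)).card ≤ k + 1} ≤
        1 / 3 * uniformProb (m * (k + 1)) {r | boolPair x r ∈ ampPost S k} := by
    intro gd _ hgd
    rw [hPost, uniformProb_eq_card_filter, mul_div_assoc']
    refine div_le_div_of_nonneg_right ?_ h2n.le
    have h1 : (univ.filter fun v : List.Vector Bool (m * (k + 1)) =>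
        v.toList ∈ {r | (∀ c : Fin (k + 1), boolPair x (stride k c.val r) ∈ S) ∧
          2 * (univ.filter fun c : Fin (k + 1) => gd (stride k c.val r)).card ≤ k + 1}) =
        univ.filter fun v : List.Vector Bool (m * (k + 1)) =>
          (fun f : Fin (k + 1) → List Bool => (∀ c, boolPair x (f c) ∈ S) ∧
            2 * (univ.filter fun c : Fin (k + 1) => gd (f c)).card ≤ k + 1)
            fun c => stride k c.val v.toList :=
      Finset.filter_congr fun v _ => Iff.rfl
    rw [h1, card_filter_stride k m (fun f : Fin (k + 1) → List Bool => (∀ c, boolPair x (f c) ∈ S) ∧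
      2 * (univ.filter fun c : Fin (k + 1) => gd (f c)).card ≤ k + 1)]
    have h2 : (univ.filter fun b : Fin (k + 1) → List.Vector Bool m =>
        (fun f : Fin (k + 1) → List Bool => (∀ c, boolPair x (f c) ∈ S) ∧
          2 * (univ.filter fun c : Fin (k + 1) => gd (f c)).card ≤ k + 1) fun c => (b c).toList) =
        univ.filter fun b : Fin (k + 1) → List.Vector Bool m => (∀ c, b c ∈ Sx) ∧
          2 * (univ.filter fun c : Fin (k + 1) => (fun v : List.Vector Bool m => gd v.toList) (b c)).card
            ≤ k + 1 := by
      refine Finset.filter_congr fun b _ => ?_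
      simp [hSx]
    rw [h2]
    exact card_forall_mem_majority_fail_le Sx hSxne (fun v : List.Vector Bool m => gd v.toList)
      hη0 hk hgd
  -- additivity and the two cases
  refine ⟨hPostPos, fun hx => ?_, fun hx => ?_⟩
  · -- `x ∈ L`: the runs in `R` are a `≥ 1 - ε = 1/2 + η` fraction of `Sx`
    have hεη : (1 : ℝ) - ε = 1 / 2 + η := by rw [hη]; ring
    have hg : (1 / 2 + η) * Sx.card ≤ (Sx.filter good).card := by
      have h1 := hyes hx
      rw [hPS, hPSR, mul_div_assoc', div_le_div_iff_of_pos_right h2m, hεη] at h1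
      exact h1
    have hf := hFail (fun r => boolPair x r ∈ R) hg
    have hadd := uniformProb_inter_add_inter_compl (m * (k + 1))
      {r | boolPair x r ∈ ampPost S k} {r | boolPair x r ∈ ampAcc R k}
    have hset : ({r | r ∈ {r | boolPair x r ∈ ampPost S k} ∧ r ∉ {r | boolPair x r ∈ ampAcc R k}} :
          Set (List Bool)) =
        {r | (∀ c : Fin (k + 1), boolPair x (stride k c.val r) ∈ S) ∧
          2 * (univ.filter fun c : Fin (k + 1) => boolPair x (stride k c.val r) ∈ R).card ≤ k + 1} := by
      ext r
      change (boolPair x r ∈ ampPost S k ∧ ¬ boolPair x r ∈ ampAcc R k) ↔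
        ((∀ c : Fin (k + 1), boolPair x (stride k c.val r) ∈ S) ∧
          2 * (univ.filter fun c : Fin (k + 1) => boolPair x (stride k c.val r) ∈ R).card ≤ k + 1)
      rw [boolPair_mem_ampPost, boolPair_mem_ampAcc, not_lt]
    rw [hset] at hadd
    have hadd' : uniformProb (m * (k + 1))
          {r | boolPair x r ∈ ampPost S k ∧ boolPair x r ∈ ampAcc R k} +
        uniformProb (m * (k + 1)) {r | (∀ c : Fin (k + 1), boolPair x (stride k c.val r) ∈ S) ∧
          2 * (univ.filter fun c : Fin (k + 1) => boolPair x (stride k c.val r) ∈ R).card ≤ k + 1} =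
        uniformProb (m * (k + 1)) {r | boolPair x r ∈ ampPost S k} := hadd
    linarith
  · -- `x ∉ L`: the runs outside `R` are a `≥ 1 - ε` fraction of `Sx`
    have hg : (1 / 2 + η) * Sx.card ≤ (Sx.filter fun v => ¬ good v).card := by
      have h1 := hno hx
      rw [hPS, hPSR, mul_div_assoc', div_le_div_iff_of_pos_right h2m] at h1
      have h3 := Finset.card_filter_add_card_filter_not (s := Sx) good
      have h4 : ((Sx.filter fun v => ¬ good v).card : ℝ) = Sx.card - (Sx.filter good).card := by
        rw [← h3]; push_cast; ring
      rw [h4, hη]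
      nlinarith [hSxpos.le]
    have hf := hFail (fun r => boolPair x r ∉ R) hg
    refine le_trans (uniformProb_mono_of_length fun r _ hr => ?_) hf
    obtain ⟨h1, h2⟩ := hr
    refine ⟨(boolPair_mem_ampPost S k x r).1 h1, ?_⟩
    have h3 := (boolPair_mem_ampAcc R k x r).1 h2
    have h4 := Finset.card_filter_add_card_filter_not
      (s := (univ : Finset (Fin (k + 1)))) (fun c : Fin (k + 1) => boolPair x (stride k c.val r) ∈ R)
    rw [Finset.card_univ, Fintype.card_fin] at h4
    omega

end Literature.Computability.QuantumComplexity
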